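import Summits.AnomalousDissipation.AnomalousDissipation.Theorems.SolenoidalFractalHomogenisationLagrangianStepCellLawVSlowGraphExistence
import Summits.AnomalousDissipation.AnomalousDissipation.Theorems.SolenoidalFractalHomogenisationLagrangianStepCellLawVSlowGraphContraction
import Literature.Analysis.FunctionSpaces.DoubledPairingLimit
import Mathlib.Analysis.ODE.ExistUnique
import Mathlib.Topology.MetricSpace.Contracting
import HarnessLib

/-!
# K1L `LagrangianRenormalisationStep(Design)` (K1L_D, stmt-AnomalousDissipation-27980; aside 24912), stub `stub_cellLawV0_IS`
# — the ABSTRACT SLOW-GRAPH LEVER, part 5: the Riccati graph from ANY graph in the ball, and the PERIODIC graph (fixed point of the period map)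
# (helper; `--supports stmt-AnomalousDissipation-27980`; word-independent)

Summits-side helper file of route `SolenoidalFractalHomogenisation` (planner ad-ideate-p5's STUB-PLAN for `stub_cellLawV` §1 (V) step V3 and §7 (a),
tenure D24-1 «`Φν := N⁻¹·Ḡν(S)` = the exact normalised PERIOD MEAN of the slow generator `A₁₁ + A₁₂L` on the attracting Riccati graph»; crux idea
`chang-slow-graph`, `Cruxes/LagrangianRenormalisationStep/SlowGraphSketch.lean` §G), on top of parts 1–4 (`…SlowGraphBall` G1 p661616, `…SlowGraphReduction`
G2/G3 p661980, `…SlowGraphExistence` G0 p662635, `…SlowGraphContraction` G4).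
* §11 `riccatiGraph_exists_of_norm_le` (G0′) — the graph from any `L₀` with `‖L₀‖ ≤ r = 2δ/(γ−s₀)` exists on `[0, T]` (proof of part 3 centred at `L₀`).
* §12 `riccatiGraph_periodic_exists` (G5) — on a window `[0, P]`, `P > 0`, there is a graph with `L P = L 0` in the ball: the period map
  `L₀ ↦ L_{L₀}(P)` maps the closed `r`-ball of the complete space `E →L[ℝ] F` into itself (G1) and contracts by `e^{−κP} < 1`, `κ = (γ−s₀)(1−r²)`
  (G4), so Banach's fixed-point theorem (`ContractingWith.exists_fixedPoint'`) applies.  With `P`-periodic coefficients this is THE attracting periodic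
  Riccati graph `L_per` — the object over whose period the reduced slow generator `A₁₁ + A₁₂L_per` is averaged in D24-1's definition of `Φν`, every
  other graph in the ball converging to it at rate `κ` (G4).
No named facts, no new definitions, no sorry.  Kokotović–Bensoussan–Blankenship 1987 §2 (2.29)/Thm 2.3 (Chang 1972), energy-dissipative version.
Infrastructure for route-1's rung leaf F-D1.A0 (frontier FORMAL rung); NOT a proof of the stub, of the crux, of Onsager's conjecture or of anomalous
dissipation.  Prover seat `ad-k1l-cellLawV-w1` g3, 2026-08-28.
-/

set_option linter.dupNamespace false

noncomputable section

namespace Summit.AnomalousDissipation.AnomalousDissipation.Theorems.SolenoidalFractalHomogenisation.LagrangianStep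

namespace SlowGraph

open Set Filter Topology Metric
open scoped InnerProductSpace NNReal

/-! ## §11 G0′ — the graph from any initial graph in the ball -/

section ExistenceFrom

/-- **G0′ — EXISTENCE OF CHANG'S RICCATI GRAPH ON `[0, T]` FROM ANY GRAPH IN THE BALL** (`‖L₀‖ ≤ r = 2δ/(γ−s₀)`; `…SlowGraphExistence`'s
`riccatiGraph_exists` is the case `L₀ = 0`).  For coefficients continuous on `[0, T]` satisfying G1's hypotheses there is `L` with `L 0 = L₀`, continuous on
`[0, T]`, solving `L̇ = A₂₁ + A₂₂L − LA₁₁ − LA₁₂L` (two-sided derivative) on `[0, T)`, with `‖L t‖ ≤ r` throughout.  Same proof as part 3 (radial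
retraction + time clamp ⇒ one Picard–Lindelöf on `[−1, T]` centred at `L₀` ⇒ Dini fencing) — adapted from `riccatiGraph_exists`.
[cite: KokotovicBensoussanBlankenship1987, §2 eq. (2.29), Thm 2.3] -/
theorem riccatiGraph_exists_of_norm_le (E F : Type) [NormedAddCommGroup E] [InnerProductSpace ℝ E] [FiniteDimensional ℝ E]
    [NormedAddCommGroup F] [InnerProductSpace ℝ F] [FiniteDimensional ℝ F]
    (A₁₁ : ℝ → E →L[ℝ] E) (A₁₂ : ℝ → F →L[ℝ] E) (A₂₁ : ℝ → E →L[ℝ] F) (A₂₂ : ℝ → F →L[ℝ] F) (γ δ s₀ T : ℝ)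
    (hδ : 0 ≤ δ) (hs₀ : 0 ≤ s₀) (hsγ : s₀ < γ) (h8 : 8 * δ ^ 2 ≤ (γ - s₀) ^ 2) (hT : 0 ≤ T)
    (hA₂₂ : ∀ t ∈ Icc 0 T, ∀ z : F, ⟪A₂₂ t z, z⟫_ℝ ≤ -γ * ‖z‖ ^ 2)
    (h₁₁ : ∀ t ∈ Icc 0 T, ‖A₁₁ t‖ ≤ s₀) (h₁₂ : ∀ t ∈ Icc 0 T, ‖A₁₂ t‖ ≤ δ) (h₂₁ : ∀ t ∈ Icc 0 T, ‖A₂₁ t‖ ≤ δ)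
    (hc₁₁ : ContinuousOn A₁₁ (Icc 0 T)) (hc₁₂ : ContinuousOn A₁₂ (Icc 0 T)) (hc₂₁ : ContinuousOn A₂₁ (Icc 0 T))
    (hc₂₂ : ContinuousOn A₂₂ (Icc 0 T)) (L₀ : E →L[ℝ] F) (hL₀ : ‖L₀‖ ≤ 2 * δ / (γ - s₀)) :
    ∃ L : ℝ → E →L[ℝ] F, L 0 = L₀ ∧ ContinuousOn L (Icc 0 T) ∧
      (∀ t ∈ Ico 0 T, HasDerivAt L (A₂₁ t + (A₂₂ t).comp (L t) - (L t).comp (A₁₁ t) - ((L t).comp (A₁₂ t)).comp (L t)) t) ∧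
      ∀ t ∈ Icc 0 T, ‖L t‖ ≤ 2 * δ / (γ - s₀) := by
  have hgs : 0 < γ - s₀ := by linarith
  rcases hδ.eq_or_lt with hδ0 | hδpos
  · -- `δ = 0`: the ball is `{0}`, the couplings vanish and `L ≡ 0` solves the equation
    have hL₀0 : L₀ = 0 := by
      rw [← norm_le_zero_iff]; rw [← hδ0] at hL₀; simpa using hL₀
    refine ⟨fun _ => 0, hL₀0.symm, continuousOn_const, fun t ht => ?_, fun t _ => ?_⟩
    · have hA : A₂₁ t = 0 := by
        rw [← norm_le_zero_iff]
        have h := h₂₁ t (Ico_subset_Icc_self ht)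
        rwa [← hδ0] at h
      have e : A₂₁ t + (A₂₂ t).comp (0 : E →L[ℝ] F) - (0 : E →L[ℝ] F).comp (A₁₁ t) -
          (((0 : E →L[ℝ] F)).comp (A₁₂ t)).comp (0 : E →L[ℝ] F) = 0 := by
        rw [hA]; simp
      rw [e]
      exact hasDerivAt_const t _
    · rw [norm_zero, ← hδ0]; simp
  · -- `δ > 0`
    set r := 2 * δ / (γ - s₀) with hr
    have hrpos : 0 < r := by positivity
    have h2δ : 2 * δ < γ - s₀ := by
      have h1 : (2 * δ) ^ 2 < (γ - s₀) ^ 2 := by nlinarith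
      exact (pow_lt_pow_iff_left₀ (by positivity) hgs.le two_ne_zero).mp h1
    have hr1 : r < 1 := (div_lt_one hgs).mpr h2δ
    -- time clamp
    set c : ℝ → ℝ := fun t => max 0 (min t T) with hc
    have hc_mem : ∀ t, c t ∈ Icc 0 T := fun t => ⟨le_max_left _ _, max_le hT (min_le_right _ _)⟩
    have hc_id : ∀ t ∈ Icc 0 T, c t = t := fun t ht => by
      show max 0 (min t T) = t
      rw [min_eq_left ht.2, max_eq_right ht.1]
    have hc_cont : Continuous c := continuous_const.max (continuous_id.min continuous_const)
    have hcA₁₁ : Continuous fun t => A₁₁ (c t) := hc₁₁.comp_continuous hc_cont hc_mem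
    have hcA₁₂ : Continuous fun t => A₁₂ (c t) := hc₁₂.comp_continuous hc_cont hc_mem
    have hcA₂₁ : Continuous fun t => A₂₁ (c t) := hc₂₁.comp_continuous hc_cont hc_mem
    have hcA₂₂ : Continuous fun t => A₂₂ (c t) := hc₂₂.comp_continuous hc_cont hc_mem
    -- a bound for `‖A₂₂‖` on the window
    obtain ⟨M, hM⟩ := isCompact_Icc.exists_bound_of_continuousOn hc₂₂
    have hM0 : 0 ≤ M := le_trans (norm_nonneg _) (hM 0 ⟨le_rfl, hT⟩)
    -- the retracted, clamped field
    set π : (E →L[ℝ] F) → (E →L[ℝ] F) := fun X => (r / max r ‖X‖) • X with hπ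
    set g : ℝ → (E →L[ℝ] F) → (E →L[ℝ] F) := fun t X =>
      A₂₁ (c t) + (A₂₂ (c t)).comp (π X) - (π X).comp (A₁₁ (c t)) - ((π X).comp (A₁₂ (c t))).comp (π X) with hg
    have hπr : ∀ X, ‖π X‖ ≤ r := fun X => (Literature.Analysis.FunctionSpaces.norm_radialTrunc_le hrpos X).1
    set K₀ : ℝ := M + s₀ + 2 * r * δ with hK₀
    set Lb : ℝ := δ + r * M + r * s₀ + r ^ 2 * δ with hLb
    have hK₀0 : 0 ≤ K₀ := by positivity
    have hLb0 : 0 ≤ Lb := by positivity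
    have hglip : ∀ t, LipschitzWith ⟨2 * K₀, by positivity⟩ (g t) := by
      intro t
      refine LipschitzWith.of_dist_le_mul fun X Y => ?_
      rw [dist_eq_norm, dist_eq_norm]
      show ‖g t X - g t Y‖ ≤ 2 * K₀ * ‖X - Y‖
      have hct := hc_mem t
      have hcoef : ‖A₂₂ (c t)‖ + ‖A₁₁ (c t)‖ + 2 * r * ‖A₁₂ (c t)‖ ≤ K₀ := by
        have := hM _ hct; have := h₁₁ _ hct; have := h₁₂ _ hct
        rw [hK₀]; gcongr
      calc ‖g t X - g t Y‖ ≤ (‖A₂₂ (c t)‖ + ‖A₁₁ (c t)‖ + 2 * r * ‖A₁₂ (c t)‖) * ‖π X - π Y‖ :=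
            norm_riccati_sub_riccati_le _ _ _ _ (hπr X) (hπr Y)
        _ ≤ K₀ * (2 * ‖X - Y‖) := mul_le_mul hcoef (norm_radial_sub_radial_le hrpos X Y) (norm_nonneg _) hK₀0
        _ = 2 * K₀ * ‖X - Y‖ := by ring
    have hgbound : ∀ t X, ‖g t X‖ ≤ Lb := by
      intro t X
      have hct := hc_mem t
      have := hM _ hct; have := h₁₁ _ hct; have := h₁₂ _ hct; have := h₂₁ _ hct
      calc ‖g t X‖ ≤ ‖A₂₁ (c t)‖ + r * ‖A₂₂ (c t)‖ + r * ‖A₁₁ (c t)‖ + r ^ 2 * ‖A₁₂ (c t)‖ := norm_riccati_le _ _ _ _ (hπr X)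
        _ ≤ δ + r * M + r * s₀ + r ^ 2 * δ := by gcongr
    have hgcont : ∀ X, Continuous fun t => g t X := by
      intro X
      exact ((hcA₂₁.add (hcA₂₂.clm_comp continuous_const)).sub (continuous_const.clm_comp hcA₁₁)).sub
        ((continuous_const.clm_comp hcA₁₂).clm_comp continuous_const)
    -- Picard–Lindelöf on `[-1, T]` from `L(0) = 0`
    have ht₀ : (0:ℝ) ∈ Icc (-1:ℝ) T := ⟨by norm_num, hT⟩
    have hPL : IsPicardLindelof g (⟨0, ht₀⟩ : Icc (-1:ℝ) T) L₀ ⟨Lb * (T + 1), by positivity⟩ 0 ⟨Lb, hLb0⟩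
        ⟨2 * K₀, by positivity⟩ :=
      { lipschitzOnWith := fun t _ => (hglip t).lipschitzOnWith
        continuousOn := fun X _ => (hgcont X).continuousOn
        norm_le := fun t _ X _ => hgbound t X
        mul_max_le := by
          show Lb * max (T - 0) (0 - (-1)) ≤ Lb * (T + 1) - (0:ℝ)
          rw [sub_zero, zero_sub, neg_neg, sub_zero]
          exact mul_le_mul_of_nonneg_left (max_le (by linarith) (by linarith)) hLb0 }
    haveI : CompleteSpace F := FiniteDimensional.complete ℝ F
    obtain ⟨L, hL0, hLd⟩ := hPL.exists_eq_forall_mem_Icc_hasDerivWithinAt₀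
    have hL00 : L 0 = L₀ := hL0
    have hLd' : ∀ t ∈ Ico 0 T, HasDerivAt L (g t (L t)) t := fun t ht =>
      (hLd t ⟨by linarith [ht.1], ht.2.le⟩).hasDerivAt (Icc_mem_nhds (by linarith [ht.1]) ht.2)
    have hLcont : ContinuousOn L (Icc 0 T) := fun t ht =>
      ((hLd t ⟨by linarith [ht.1], ht.2⟩).continuousWithinAt).mono (Icc_subset_Icc (by norm_num) le_rfl)
    -- the retracted field IS the Riccati field on the ball, on the window
    have hg_eq : ∀ t ∈ Icc 0 T, ∀ X : E →L[ℝ] F, ‖X‖ ≤ r →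
        g t X = A₂₁ t + (A₂₂ t).comp X - X.comp (A₁₁ t) - (X.comp (A₁₂ t)).comp X := by
      intro t ht X hX
      have hπX : π X = X := Literature.Analysis.FunctionSpaces.radialTrunc_eq_self hrpos hX
      simp only [hg, hπX, hc_id t ht]
    -- fencing: the solution stays in the ball
    have hball : ∀ t ∈ Icc 0 T, ‖L t‖ ≤ r := by
      have hcontn : ContinuousOn (fun t => ‖L t‖) (Icc 0 T) := continuous_norm.comp_continuousOn hLcont
      classical
      set f' : ℝ → ℝ := fun x => if ‖L x‖ ≤ r then δ + ‖L x‖ * s₀ - γ * ‖L x‖ + δ * ‖L x‖ ^ 2 else ‖g x (L x)‖ with hf'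
      have hDini : ∀ x ∈ Ico 0 T, ∀ ρ, f' x < ρ → ∃ᶠ z in 𝓝[>] x, slope (fun t => ‖L t‖) x z < ρ := by
        intro x hx ρ hρ
        have hxI := Ico_subset_Icc_self hx
        by_cases hxr : ‖L x‖ ≤ r
        · have hρ' : δ + ‖L x‖ * s₀ - γ * ‖L x‖ + δ * ‖L x‖ ^ 2 < ρ := by simpa [hf', hxr] using hρ
          have hd : HasDerivAt L (A₂₁ x + (A₂₂ x).comp (L x) - (L x).comp (A₁₁ x) - ((L x).comp (A₁₂ x)).comp (L x)) x := by
            rw [← hg_eq x hxI (L x) hxr]; exact hLd' x hx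
          exact frequently_slope_norm_lt_riccati (hA₂₂ x hxI) (h₁₁ x hxI) (h₁₂ x hxI) (h₂₁ x hxI) hd hρ'
        · have hρ' : ‖g x (L x)‖ < ρ := by simpa [hf', hxr] using hρ
          exact (hLd' x hx).hasDerivWithinAt.liminf_right_slope_norm_le hρ'
      have h0 : ‖L 0‖ ≤ r := by rw [hL00]; exact hL₀
      have key := image_le_of_liminf_slope_right_lt_deriv_boundary' (f := fun t => ‖L t‖) (f' := f') hcontn hDini
        (B := fun _ => r) (B' := fun _ => (0:ℝ)) h0 continuousOn_const (fun x _ => (hasDerivAt_const x r).hasDerivWithinAt) ?_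
      · exact fun t ht => key ht
      · intro x _ hxr
        have hle : ‖L x‖ ≤ r := hxr.le
        have ef : f' x = δ + r * s₀ - γ * r + δ * r ^ 2 := by simp only [hf', if_pos hle, hxr]
        rw [ef]
        have e : δ + r * s₀ - γ * r + δ * r ^ 2 = δ * (r ^ 2 - 1) := by
          rw [hr]; field_simp; ring
        rw [e]
        have : r ^ 2 < 1 := by nlinarith
        nlinarith
    refine ⟨L, hL00, hLcont, fun t ht => ?_, hball⟩
    rw [← hg_eq t (Ico_subset_Icc_self ht) (L t) (hball t (Ico_subset_Icc_self ht))]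
    exact hLd' t ht


end ExistenceFrom

/-! ## §12 G5 — the PERIODIC graph: the fixed point of the period map on the closed `r`-ball -/

section Periodic

/-- **G5 — THE PERIODIC RICCATI GRAPH.**  On a window `[0, P]`, `P > 0`, with coefficients continuous on `[0, P]` satisfying G1's hypotheses, there is a
solution `L` of `L̇ = A₂₁ + A₂₂L − LA₁₁ − LA₁₂L` on `[0, P)` in the ball `‖L t‖ ≤ r = 2δ/(γ−s₀)` which RETURNS TO ITS INITIAL GRAPH, `L P = L 0`: the
period map `L₀ ↦ L_{L₀}(P)` is a self-map of the closed `r`-ball of the complete space `E →L[ℝ] F` (G0′, G1) contracting by `e^{−κP} < 1`,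
`κ = (γ−s₀)(1−r²)` (G4), and Banach's fixed-point theorem applies.  For `P`-periodic coefficients this is the attracting periodic graph `L_per` of
Chang's decoupling (the graph over whose period D24-1's `Φν` averages the reduced slow generator); every graph in the ball converges to it at rate `κ`
(`riccati_contraction`). [cite: KokotovicBensoussanBlankenship1987, §2 eq. (2.29), Thm 2.3] -/
theorem riccatiGraph_periodic_exists (E F : Type) [NormedAddCommGroup E] [InnerProductSpace ℝ E] [FiniteDimensional ℝ E]
    [NormedAddCommGroup F] [InnerProductSpace ℝ F] [FiniteDimensional ℝ F]
    (A₁₁ : ℝ → E →L[ℝ] E) (A₁₂ : ℝ → F →L[ℝ] E) (A₂₁ : ℝ → E →L[ℝ] F) (A₂₂ : ℝ → F →L[ℝ] F) (γ δ s₀ P : ℝ)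
    (hδ : 0 ≤ δ) (hs₀ : 0 ≤ s₀) (hsγ : s₀ < γ) (h8 : 8 * δ ^ 2 ≤ (γ - s₀) ^ 2) (hP : 0 < P)
    (hA₂₂ : ∀ t ∈ Icc 0 P, ∀ z : F, ⟪A₂₂ t z, z⟫_ℝ ≤ -γ * ‖z‖ ^ 2)
    (h₁₁ : ∀ t ∈ Icc 0 P, ‖A₁₁ t‖ ≤ s₀) (h₁₂ : ∀ t ∈ Icc 0 P, ‖A₁₂ t‖ ≤ δ) (h₂₁ : ∀ t ∈ Icc 0 P, ‖A₂₁ t‖ ≤ δ)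
    (hc₁₁ : ContinuousOn A₁₁ (Icc 0 P)) (hc₁₂ : ContinuousOn A₁₂ (Icc 0 P)) (hc₂₁ : ContinuousOn A₂₁ (Icc 0 P))
    (hc₂₂ : ContinuousOn A₂₂ (Icc 0 P)) :
    ∃ L : ℝ → E →L[ℝ] F, L P = L 0 ∧ ContinuousOn L (Icc 0 P) ∧
      (∀ t ∈ Ico 0 P, HasDerivAt L (A₂₁ t + (A₂₂ t).comp (L t) - (L t).comp (A₁₁ t) - ((L t).comp (A₁₂ t)).comp (L t)) t) ∧
      ∀ t ∈ Icc 0 P, ‖L t‖ ≤ 2 * δ / (γ - s₀) := by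
  have hγ : 0 < γ := lt_of_le_of_lt hs₀ hsγ
  have hgs : 0 < γ - s₀ := by linarith
  set r := 2 * δ / (γ - s₀) with hr
  have hr0 : 0 ≤ r := by positivity
  have hr2 : r ^ 2 ≤ 1 / 2 := by
    rw [hr, div_pow, div_le_div_iff₀ (by positivity) (by norm_num)]
    nlinarith
  -- the solution from each graph in the ball (G0′)
  have hsol := fun (X : E →L[ℝ] F) (hX : ‖X‖ ≤ r) =>
    riccatiGraph_exists_of_norm_le E F A₁₁ A₁₂ A₂₁ A₂₂ γ δ s₀ P hδ hs₀ hsγ h8 hP.le hA₂₂ h₁₁ h₁₂ h₂₁ hc₁₁ hc₁₂ hc₂₁ hc₂₂ X hX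
  classical
  -- the period map (extended by `0` off the ball)
  set Pm : (E →L[ℝ] F) → (E →L[ℝ] F) := fun X => if hX : ‖X‖ ≤ r then Classical.choose (hsol X hX) P else 0 with hPmdef
  have hPm : ∀ (X : E →L[ℝ] F) (hX : ‖X‖ ≤ r), Pm X = Classical.choose (hsol X hX) P := fun X hX => by
    simp only [hPmdef, dif_pos hX]
  have hmaps : MapsTo Pm (closedBall 0 r) (closedBall 0 r) := by
    intro X hX
    rw [mem_closedBall_zero_iff] at hX ⊢
    rw [hPm X hX]
    exact (Classical.choose_spec (hsol X hX)).2.2.2 P ⟨hP.le, le_rfl⟩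
  -- contraction factor
  have hκpos : 0 < (γ - s₀) * (1 - (2 * δ / (γ - s₀)) ^ 2) := mul_pos hgs (by rw [← hr]; linarith)
  set K : ℝ≥0 := ⟨Real.exp (-((γ - s₀) * (1 - (2 * δ / (γ - s₀)) ^ 2)) * P), (Real.exp_pos _).le⟩ with hK
  have hK1 : K < 1 := by
    rw [← NNReal.coe_lt_coe]
    change Real.exp (-((γ - s₀) * (1 - (2 * δ / (γ - s₀)) ^ 2)) * P) < (1:ℝ)
    exact Real.exp_lt_one_iff.mpr (by nlinarith)
  have hlip : LipschitzWith K (hmaps.restrict Pm (closedBall 0 r) (closedBall 0 r)) := by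
    refine LipschitzWith.of_dist_le_mul fun X Y => ?_
    have hX : ‖(X : E →L[ℝ] F)‖ ≤ r := mem_closedBall_zero_iff.mp X.2
    have hY : ‖(Y : E →L[ℝ] F)‖ ≤ r := mem_closedBall_zero_iff.mp Y.2
    rw [Subtype.dist_eq, MapsTo.val_restrict_apply, MapsTo.val_restrict_apply, Subtype.dist_eq, dist_eq_norm, dist_eq_norm, hPm _ hX, hPm _ hY]
    change _ ≤ Real.exp (-((γ - s₀) * (1 - (2 * δ / (γ - s₀)) ^ 2)) * P) * ‖(X : E →L[ℝ] F) - Y‖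
    obtain ⟨hX0, hXc, hXd, _⟩ := Classical.choose_spec (hsol X hX)
    obtain ⟨hY0, hYc, hYd, _⟩ := Classical.choose_spec (hsol Y hY)
    have h := riccati_contraction E F A₁₁ A₁₂ A₂₁ A₂₂ (Classical.choose (hsol X hX)) (Classical.choose (hsol Y hY)) γ δ s₀ P
      hγ hδ hs₀ hsγ h8 hP.le hA₂₂ h₁₁ h₁₂ h₂₁ hXd hYd hXc hYc (by rw [hX0]; exact hX) (by rw [hY0]; exact hY) P ⟨hP.le, le_rfl⟩
    rwa [hX0, hY0] at h
  have hcontr : ContractingWith K (hmaps.restrict Pm (closedBall 0 r) (closedBall 0 r)) := ⟨hK1, hlip⟩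
  haveI : CompleteSpace F := FiniteDimensional.complete ℝ F
  obtain ⟨Lstar, hmem, hfix, -⟩ := ContractingWith.exists_fixedPoint' (isClosed_closedBall.isComplete) hmaps hcontr
    (mem_closedBall_self hr0 : (0 : E →L[ℝ] F) ∈ closedBall 0 r) (edist_ne_top _ _)
  have hLstar : ‖Lstar‖ ≤ r := mem_closedBall_zero_iff.mp hmem
  obtain ⟨h0, hc, hd, hb⟩ := Classical.choose_spec (hsol Lstar hLstar)
  refine ⟨Classical.choose (hsol Lstar hLstar), ?_, hc, hd, hb⟩
  rw [h0, ← hPm Lstar hLstar]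
  exact hfix

end Periodic

end SlowGraph

end Summit.AnomalousDissipation.AnomalousDissipation.Theorems.SolenoidalFractalHomogenisation.LagrangianStep

end
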